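import Mathlib
import Summits.MatrixMultiplication.MatrixMultiplication.Theorems.FourierTwoFamiliesModPPrimeTwoFamiliesPaleyCapacityMinusOne

/-!
# Transitive tournaments of `P_q^n` have at most `((q-1)/2)^n` vertices (`q ≡ 3 (mod 4)` prime, `q ≥ 7`)

Crux `PrimeTwoFamilies` (stmt-MatrixMultiplication-14308, route `FourierTwoFamiliesModP`), line `Sketch`, stub
`stub_paleyCapacity`; lead c4, companion of `…PaleyCapacityMinusOne.lean`.

The Sperner capacity of a digraph can be defined either through SYMMETRIC cliques of its powers (every ordered
pair of distinct words separated; Gargano–Körner–Vaccaro) or through TRANSITIVE tournaments of its powers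
(Sali–Simonyi 1999, Def. 2: sequences of words, every earlier word pointing to every later one); both grow at
the same exponential rate, but the transitive numbers converge faster and are what the finite census of this
crux computes (`tr(q, t)`).  The rank certificate of the companion file bounds the transitive version just as
well — the value matrix becomes TRIANGULAR with non-zero diagonal instead of diagonal:

* `length_le_pow_of_eval_span` — the ordered form of the engine `card_le_pow_of_eval_span` (p173048);
* `length_le_card_pow_of_vanishing_frequencies` — the abstract certificate, ordered form;
* `length_le_pow_half_of_paley_chain` — every sequence of words in `(ZMod q)^n` in which each earlier word
  points to each later one in some coordinate (difference a non-zero square) has length `≤ ((q-1)/2)^n`.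

In particular `tr(7, t) ≤ 3^t` for all `t` (so `tr(7, 2) = 9` is tight and `tr(7, 3) = 27`, the value the
finite census of lead c3 left pending), and `tr(11, t) ≤ 5^t`, `tr(19, t) ≤ 9^t`, `tr(23, t) ≤ 11^t`.
-/

-- the summit path `Summits/MatrixMultiplication/MatrixMultiplication/…` forces the repeated namespace segment
set_option linter.dupNamespace false

namespace Summit.MatrixMultiplication.MatrixMultiplication.Theorems.PrimeTwoFamilies.PaleyRankBound

open Finset

/-- **The evaluation-span engine, ordered form.**  If `s₀, …, s_{N-1}` is a SEQUENCE of words `Fin n → V`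
and word `a` comes with functions `f a i : V → F` in the span of the `|J|` functions `b j`, non-vanishing at
`s a i`, such that for every LATER word `b > a` some `f a i` vanishes at `s b i`, then `N ≤ |J|^n`: the value
matrix `(∏_i f a i (s b i))_{a,b}` is lower-triangular with non-zero diagonal, so the product functions are
linearly independent inside the `|J|^n`-dimensional span of the products of the `b j`.  (Ordered form of
`card_le_pow_of_eval_span`; cf. `Literature.Combinatorics.Extremal.length_le_pow_of_eval_polynomials`.) -/
theorem length_le_pow_of_eval_span {F V J : Type*} [Field F] [Fintype J]
    {n N : ℕ} (b : J → V → F) (s : Fin N → (Fin n → V)) (f : Fin N → Fin n → V → F)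
    (hspan : ∀ a i, ∃ c : J → F, ∀ x, f a i x = ∑ j, c j * b j x)
    (hdiag : ∀ a i, f a i (s a i) ≠ 0)
    (hoff : ∀ a b, a < b → ∃ i, f a i (s b i) = 0) :
    N ≤ Fintype.card J ^ n := by
  classical
  let P : Fin N → (Fin n → V) → F := fun a x => ∏ i, f a i (x i)
  let M : (Fin n → J) → (Fin n → V) → F := fun e x => ∏ i, b (e i) (x i)
  let W : Submodule F ((Fin n → V) → F) := Submodule.span F (Set.range M)
  -- (1) every `P a` lies in the span `W` of the `|J|^n` products `M e`
  have hPW : ∀ a, P a ∈ W := by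
    intro a
    choose c hc using fun i => hspan a i
    have hexp : P a = ∑ e : Fin n → J, (∏ i, c i (e i)) • M e := by
      funext x
      rw [Finset.sum_apply]
      simp only [P, M, Pi.smul_apply, smul_eq_mul]
      simp_rw [hc]
      rw [Fintype.prod_sum]
      refine Finset.sum_congr rfl fun e _ => ?_
      rw [Finset.prod_mul_distrib]
    rw [hexp]
    refine Submodule.sum_mem _ fun e _ => Submodule.smul_mem _ _ ?_
    exact Submodule.subset_span ⟨e, rfl⟩
  -- (2) the value matrix is triangular with non-zero diagonal
  have hzero : ∀ a b, a < b → P a (s b) = 0 := by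
    intro a b hab
    obtain ⟨i, hi⟩ := hoff a b hab
    exact Finset.prod_eq_zero (Finset.mem_univ i) hi
  have hne0 : ∀ a, P a (s a) ≠ 0 := fun a =>
    Finset.prod_ne_zero_iff.mpr fun i _ => hdiag a i
  -- (3) triangular ⇒ linearly independent: peel off the maximal index
  have hli : LinearIndependent F (fun a : Fin N => (⟨P a, hPW a⟩ : W)) := by
    apply LinearIndependent.of_comp W.subtype
    rw [linearIndependent_iff']
    intro t
    refine Finset.induction_on_max t (fun g _ a ha => absurd ha (Finset.notMem_empty a)) ?_
    intro m t hlt ih g hg a ha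
    have hm : m ∉ t := fun h => lt_irrefl m (hlt m h)
    rw [Finset.sum_insert hm] at hg
    have hgm : g m = 0 := by
      have h := congrFun hg (s m)
      simp only [Pi.add_apply, Finset.sum_apply, Function.comp_apply, Submodule.subtype_apply,
        Pi.smul_apply, smul_eq_mul, Pi.zero_apply] at h
      rw [Finset.sum_eq_zero (fun x hx => by rw [hzero x m (hlt x hx), mul_zero]), add_zero] at h
      exact (mul_eq_zero.mp h).resolve_right (hne0 m)
    rw [hgm, zero_smul, zero_add] at hg
    rcases Finset.mem_insert.mp ha with rfl | ha'
    · exact hgm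
    · exact ih g hg a ha'
  -- (4) count dimensions
  haveI : Module.Finite F W := Module.Finite.span_of_finite F (Set.finite_range M)
  have h1 : Fintype.card (Fin N) ≤ Module.finrank F W := hli.fintype_card_le_finrank
  have h2 : Module.finrank F W ≤ Fintype.card (Fin n → J) := finrank_range_le_card M
  rw [Fintype.card_fin] at h1
  rw [Fintype.card_fun, Fintype.card_fin] at h2
  exact h1.trans h2

/-- **The rank certificate, ordered form.**  With `ψ`, `K` as in `card_le_card_pow_of_vanishing_frequencies`
(`(|K| : F) ≠ 0`, `∑_{k∈K} ψ(k d) = 0` for every non-zero square `d`), every sequence of words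
`s₀, …, s_{N-1}` in `(ZMod q)^n` such that for all `a < b` some coordinate `i` has `s b i - s a i` a non-zero
square has `N ≤ |K|^n`. -/
theorem length_le_card_pow_of_vanishing_frequencies {q : ℕ} [NeZero q] {F : Type*} [Field F]
    (ψ : AddChar (ZMod q) F) (K : Finset (ZMod q)) (hK0 : ((K.card : ℕ) : F) ≠ 0)
    (hKvan : ∀ d : ZMod q, d ≠ 0 → IsSquare d → ∑ k ∈ K, ψ (k * d) = 0)
    {n N : ℕ} (s : Fin N → (Fin n → ZMod q))
    (hs : ∀ a b : Fin N, a < b → ∃ i, s a i ≠ s b i ∧ IsSquare (s b i - s a i)) :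
    N ≤ K.card ^ n := by
  classical
  let b : ↥K → ZMod q → F := fun k x => ψ ((k : ZMod q) * x)
  let f : Fin N → Fin n → ZMod q → F := fun a i x => ∑ k ∈ K, ψ (k * (x - s a i))
  have h := length_le_pow_of_eval_span b s f ?_ ?_ ?_
  · simpa [Fintype.card_coe] using h
  · intro a i
    refine ⟨fun k => ψ (-((k : ZMod q) * s a i)), fun x => ?_⟩
    simp only [f, b]
    rw [← Finset.sum_coe_sort K]
    refine Finset.sum_congr rfl fun k _ => ?_
    rw [← AddChar.map_add_eq_mul]
    congr 1
    ring
  · intro a i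
    simp only [f, sub_self, mul_zero, AddChar.map_zero_eq_one, Finset.sum_const, nsmul_eq_mul,
      mul_one]
    exact hK0
  · intro a b hab
    obtain ⟨i, hne_i, hsq⟩ := hs a b hab
    exact ⟨i, hKvan _ (sub_ne_zero.mpr (Ne.symm hne_i)) hsq⟩

/-- **Transitive tournaments in powers of the Paley tournament, minus one.**  Let `q ≥ 7` be a prime,
`q ≡ 3 (mod 4)`, and `s₀, …, s_{N-1}` words in `(ZMod q)^n` such that for all `a < b` some coordinate `i` has
`s b i - s a i` a non-zero square (the words span a transitive tournament of `P_q^n`, earlier words pointing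
to later ones).  Then `N ≤ ((q-1)/2)^n` — one less in the base than
`Literature.Combinatorics.Extremal.length_le_pow_of_paley_chain`.  (`q = 7`: `tr(7, n) ≤ 3^n`, attained by
`{0,1,2}^n` in product order.) -/
theorem length_le_pow_half_of_paley_chain {q : ℕ} [hq : Fact q.Prime] (hq3 : q % 4 = 3) (hq7 : 7 ≤ q)
    {n N : ℕ} (s : Fin N → (Fin n → ZMod q))
    (hs : ∀ a b : Fin N, a < b → ∃ i, s a i ≠ s b i ∧ IsSquare (s b i - s a i)) :
    N ≤ (q / 2) ^ n := by
  obtain ⟨ℓ, hℓ, ψ, K, hK, hK0, hvan⟩ := exists_paley_vanishing_frequencies hq3 hq7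
  haveI : NeZero q := ⟨hq.out.ne_zero⟩
  rw [← hK]
  exact length_le_card_pow_of_vanishing_frequencies ψ K hK0 hvan s hs

/-- `tr(7, n) ≤ 3^n`: a transitive tournament of `P_7^n` (words over `Fin 7`, each earlier word pointing to
each later one by a square difference mod 7 in some coordinate) has at most `3^n` vertices; with the product
order on `{0,1,2}^n` this is an equality, so `tr(7, 2) = 9` and `tr(7, 3) = 27`. -/
theorem length_le_three_pow_of_paley_seven_chain {n N : ℕ} (s : Fin N → (Fin n → Fin 7))
    (hs : ∀ a b : Fin N, a < b →
      ∃ t : Fin n, s a t ≠ s b t ∧ IsSquare (((s b t : ℕ) : ZMod 7) - ((s a t : ℕ) : ZMod 7))) :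
    N ≤ 3 ^ n := by
  haveI : Fact (Nat.Prime 7) := ⟨by norm_num⟩
  let φ : (Fin n → Fin 7) → (Fin n → ZMod 7) := fun w t => ((w t : ℕ) : ZMod 7)
  have hcast : ∀ a b : Fin 7, ((a : ℕ) : ZMod 7) = ((b : ℕ) : ZMod 7) → a = b := by
    intro a b h
    apply Fin.ext
    have := (ZMod.natCast_eq_natCast_iff' a b 7).mp h
    rwa [Nat.mod_eq_of_lt a.isLt, Nat.mod_eq_of_lt b.isLt] at this
  refine length_le_pow_half_of_paley_chain (q := 7) (by norm_num) le_rfl (φ ∘ s) ?_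
  intro a b hab
  obtain ⟨t, ht, hsq⟩ := hs a b hab
  exact ⟨t, fun e => ht (hcast _ _ e), hsq⟩

end Summit.MatrixMultiplication.MatrixMultiplication.Theorems.PrimeTwoFamilies.PaleyRankBound
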